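import Summits.AtomisticToContinuum.FouriersLaw.Theses.CageBudgetFekete
import Summits.AtomisticToContinuum.FouriersLaw.Theorems.CageBudgetFeketeHeatVarianceCalculus
import Summits.AtomisticToContinuum.FouriersLaw.Theorems.EmbeddedDrudeMourreMourreDissolutionCosineBochner
import Literature.MathematicalPhysics.KineticTheory.InfiniteChainCurrentPositiveType
import HarnessLib

/-!
# Stub `stub_currentSpectralMeasure` of line `birth`
(crux `CageBudgetFekete.UnboundedHeatVariance`, item stmt-AtomisticToContinuum-15771; `--supports` file, closes nothing)

WHAT. The registered stub S1 of the crux's skeleton (`Cruxes/UnboundedHeatVariance/Lines/birth.lean`): in the crux's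
arena — the pinned anharmonic chain `pinnedChain ω₂ lam β γ` (`ω₂, lam, β > 0`), a shift-invariant DLR state `μ` at
`T > 0`, a `μ`-preserving dynamics `D` with absolutely convergent summed current correlations
`C(t) = D.currentCorrelation μ t` at every time and `C` continuous — there is a finite (positive) measure `ρ` on `ℝ`,
the spectral measure of the current class, with the Helfand–Bochner representation `C(t) = ∫ cos(ωt) dρ(ω)` (`t ≥ 0`).

HOW. (R) Dynamics rigidity (`Theorems.HeatVarianceCalculus.CanonicalRigidity.flow_ae_eq_canonical`): `D` agrees
`μ`-a.e. at all times with the canonical Buttà–Marchioro dynamics `D♭` of `OscillatorChain.exists_bmDynamics`, so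
`C = C♭` termwise and `D♭` inherits absolute convergence; `D♭` commutes with the translations a.e.
(`flow_comp_chainShift_ae_of_carrier_subset_bmGood`). (F) Fejér representation
(`tendsto_inv_mul_integral_block_mul_block_flow`): `C(t) = lim_n n⁻¹ Φₙ(t)` with
`Φₙ(t) = ∫ Jₙ · (Jₙ ∘ φ_t) dμ`, `Jₙ = Σ_{i<n} j_i ∈ L²(μ)`. (E/P) Each `Φₙ` is a genuine stationary `L²(μ)`
autocorrelation, hence EVEN (`integral_mul_comp_flow_neg`) and POSITIVE SEMI-DEFINITE
(`Σᵢⱼ cᵢcⱼ Φₙ(τⱼ − τᵢ) = ∫ (Σᵢ cᵢ Jₙ ∘ φ_{τᵢ})² dμ ≥ 0`, stationarity `integral_comp_flow_mul_comp_flow_eq`); both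
properties pass to the limit `C`. (B) The landed cosine Bochner theorem
(`Theorems.MourreDissolution.stub_cosineBochner`) gives `ρ`.

[cite: Helfand1960] [cite: ButtaMarchioro2016, §2 Thm 2.1, eq. (2.6) and §3]
-/

noncomputable section

namespace Summit.AtomisticToContinuum.FouriersLaw.Theorems.UnboundedHeatVariance.Birth

open MeasureTheory Filter Set Function
open scoped Topology BigOperators
open Literature.MathematicalPhysics.KineticTheory.HeatConduction

/-- **Positive semi-definiteness of a stationary `L²` autocorrelation.** For a `μ`-preserving dynamics `D`
and `g ∈ L²(μ)` measurable, the kernel `(s, u) ↦ F_g(u - s)`, `F_g(t) = ∫ g · (g ∘ φ_t) dμ`, is positive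
semi-definite over real coefficient vectors:
`Σᵢⱼ cᵢ cⱼ F_g(τⱼ − τᵢ) = ∫ (Σᵢ cᵢ g(φ_{τᵢ} σ))² dμ(σ) ≥ 0` (stationarity
`∫ (g ∘ φ_s)(g ∘ φ_u) dμ = F_g(u − s)`). [folklore] -/
theorem sum_mul_integral_mul_comp_flow_nonneg {P : OscillatorChain} (D : InfiniteChainDynamics P)
    {μ : Measure ChainConfig} (hD : D.PreservesMeasure μ) {g : ChainConfig → ℝ} (hg : Measurable g)
    (hg2 : MemLp g 2 μ) (m : ℕ) (c τ : Fin m → ℝ) :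
    0 ≤ ∑ i, ∑ j, c i * c j * ∫ σ, g σ * g (D.flow (τ j - τ i) σ) ∂μ := by
  have hint : ∀ i j : Fin m, Integrable
      (fun σ => c i * g (D.flow (τ i) σ) * (c j * g (D.flow (τ j) σ))) μ := fun i j =>
    ((D.integrable_comp_flow_mul_comp_flow hD hg2 (τ i) (τ j)).const_mul (c i * c j)).congr
      (Eventually.of_forall fun σ => by ring)
  have hterm : ∀ i j : Fin m, c i * c j * ∫ σ, g σ * g (D.flow (τ j - τ i) σ) ∂μ =
      ∫ σ, c i * g (D.flow (τ i) σ) * (c j * g (D.flow (τ j) σ)) ∂μ := fun i j => by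
    rw [← D.integral_comp_flow_mul_comp_flow_eq hD hg (τ i) (τ j), ← integral_const_mul]
    refine integral_congr_ae (Eventually.of_forall fun σ => ?_)
    ring
  have hsq : ∫ σ, (∑ i, c i * g (D.flow (τ i) σ)) ^ 2 ∂μ =
      ∑ i, ∑ j, c i * c j * ∫ σ, g σ * g (D.flow (τ j - τ i) σ) ∂μ :=
    calc ∫ σ, (∑ i, c i * g (D.flow (τ i) σ)) ^ 2 ∂μ
        = ∫ σ, ∑ i, ∑ j, c i * g (D.flow (τ i) σ) * (c j * g (D.flow (τ j) σ)) ∂μ := by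
          refine integral_congr_ae (Eventually.of_forall fun σ => ?_)
          simp only [sq, Finset.sum_mul_sum]
      _ = ∑ i, ∫ σ, ∑ j, c i * g (D.flow (τ i) σ) * (c j * g (D.flow (τ j) σ)) ∂μ :=
          integral_finsetSum _ fun i _ => integrable_finsetSum _ fun j _ => hint i j
      _ = ∑ i, ∑ j, ∫ σ, c i * g (D.flow (τ i) σ) * (c j * g (D.flow (τ j) σ)) ∂μ :=
          Finset.sum_congr rfl fun i _ => integral_finsetSum _ fun j _ => hint i j
      _ = ∑ i, ∑ j, c i * c j * ∫ σ, g σ * g (D.flow (τ j - τ i) σ) ∂μ :=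
          Finset.sum_congr rfl fun i _ => Finset.sum_congr rfl fun j _ => (hterm i j).symm
  rw [← hsq]
  exact integral_nonneg fun σ => sq_nonneg _

/-- **Stub S1 `stub_currentSpectralMeasure` (registered signature, verbatim): Helfand–Bochner representation of
the summed current autocorrelation.** In the arena of `CageBudgetFekete.UnboundedHeatVariance` there is a finite
measure `ρ` on `ℝ` with `D.currentCorrelation μ t = ∫ cos(ωt) dρ(ω)` for every `t ≥ 0`: by rigidity `D` is the
canonical Buttà–Marchioro dynamics a.e., whose summed current autocorrelation is the Fejér limit
`lim_n n⁻¹ ∫ Jₙ (Jₙ ∘ φ_t) dμ` of stationary `L²(μ)` autocorrelations, hence even and of positive type; it is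
continuous by hypothesis, and the cosine Bochner theorem (`Theorems.MourreDissolution.stub_cosineBochner`)
applies. The momentum-reversal and a.e. shift-covariance hypotheses are idle (rigidity).
[cite: Helfand1960] [cite: ButtaMarchioro2016, §2 Thm 2.1, eq. (2.6) and §3] -/
theorem stub_currentSpectralMeasure :
    ∀ ω₂ lam β γ : ℝ, 0 < ω₂ → 0 < lam → 0 < β → ∀ T : ℝ, 0 < T → ∀ μ : MeasureTheory.Measure Literature.MathematicalPhysics.KineticTheory.HeatConduction.ChainConfig, (Literature.MathematicalPhysics.KineticTheory.HeatConduction.pinnedChain ω₂ lam β γ).IsChainGibbsMeasure T μ → Literature.MathematicalPhysics.KineticTheory.HeatConduction.IsShiftInvariant μ → μ.map (fun σ : Literature.MathematicalPhysics.KineticTheory.HeatConduction.ChainConfig => fun x : ℤ => ((σ x).1, -(σ x).2)) = μ → ∀ D : Literature.MathematicalPhysics.KineticTheory.HeatConduction.InfiniteChainDynamics (Literature.MathematicalPhysics.KineticTheory.HeatConduction.pinnedChain ω₂ lam β γ), D.PreservesMeasure μ → (∀ t : ℝ, ∀ᵐ σ ∂μ, D.flow t (Literature.MathematicalPhysics.KineticTheory.HeatConduction.shift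 σ) = Literature.MathematicalPhysics.KineticTheory.HeatConduction.shift (D.flow t σ)) → (∀ t : ℝ, D.HasAbsConvergentCorrelation μ t) → Continuous (fun t : ℝ => D.currentCorrelation μ t) → ∃ ρ : MeasureTheory.Measure ℝ, MeasureTheory.IsFiniteMeasure ρ ∧ ∀ t : ℝ, 0 ≤ t → D.currentCorrelation μ t = ∫ w : ℝ, Real.cos (w * t) ∂ρ := by
  intro ω₂ lam β γ hω hl hβ T hT μ hG hSI _ D hP _ hAC hCc
  -- superstability of the shift-invariant Gibbs state and the polynomial data of the chain (in tree)
  have hss : (pinnedChain ω₂ lam β γ).HasSuperstabilityEstimate μ :=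
    OscillatorChain.hasSuperstabilityEstimate_of_isShiftInvariant_pinnedChain γ hω hl.le hβ.le hT hG hSI
  have hU0 : ∀ q : ℝ, 0 ≤ (pinnedChain ω₂ lam β γ).U q :=
    OscillatorChain.pinnedChain_U_nonneg β γ hω.le hl.le
  have hUm : Measurable (pinnedChain ω₂ lam β γ).U := OscillatorChain.measurable_pinnedChain_U ω₂ lam β γ
  have hU2 : OscillatorChain.IsEvenPolyOfDegree (pinnedChain ω₂ lam β γ).U 2 :=
    OscillatorChain.pinnedChain_isEvenPolyOfDegree_U β γ hω.le hl
  have hV2 : OscillatorChain.IsEvenPolyOfDegree (pinnedChain ω₂ lam β γ).V 2 :=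
    OscillatorChain.pinnedChain_isEvenPolyOfDegree_V ω₂ lam γ hβ
  have hj2 : ∀ x : ℤ, MemLp (fun σ => (pinnedChain ω₂ lam β γ).bondCurrentZ σ x) 2 μ := fun x =>
    hss.memLp_bondCurrentZ one_le_two hU0 hUm hV2 x ENNReal.ofNat_ne_top
  -- the canonical Buttà–Marchioro dynamics `D♭` (carrier `bmGood`) and RIGIDITY: `D = D♭` a.e. at all times
  obtain ⟨D', hcar, -, -, -, -, -, hpresAll⟩ :=
    OscillatorChain.exists_bmDynamics (P := pinnedChain ω₂ lam β γ) one_le_two one_le_two hU2 hV2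
  have hP' : D'.PreservesMeasure μ := hpresAll T μ hG hss
  have hrig : ∀ᵐ σ ∂μ, ∀ t : ℝ, D.flow t σ = D'.flow t σ :=
    Summit.AtomisticToContinuum.FouriersLaw.Theorems.HeatVarianceCalculus.CanonicalRigidity.flow_ae_eq_canonical
      γ hω hl hβ hT hG hSI D D' hP hcar
  have hterm : ∀ (t : ℝ) (x : ℤ),
      ∫ σ, (pinnedChain ω₂ lam β γ).bondCurrentZ σ 0 *
          (pinnedChain ω₂ lam β γ).bondCurrentZ (D.flow t σ) x ∂μ =
        ∫ σ, (pinnedChain ω₂ lam β γ).bondCurrentZ σ 0 *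
          (pinnedChain ω₂ lam β γ).bondCurrentZ (D'.flow t σ) x ∂μ := fun t x => by
    refine integral_congr_ae ?_
    filter_upwards [hrig] with σ hσ
    rw [hσ t]
  have hCC' : ∀ t : ℝ, D.currentCorrelation μ t = D'.currentCorrelation μ t := fun t => by
    unfold InfiniteChainDynamics.currentCorrelation
    exact tsum_congr fun x => hterm t x
  have hAC' : ∀ t : ℝ, D'.HasAbsConvergentCorrelation μ t := fun t => by
    refine ⟨fun x => hss.integrable_bondCurrentZ_mul_comp one_le_two hU0 hUm hV2 (hP'.2 t) x 0, ?_⟩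
    have h := (hAC t).2
    simp only [hterm] at h
    exact h
  -- a.e. shift covariance of the canonical dynamics (carrier `= bmGood`)
  have hcomm' : ∀ (t : ℝ) (x : ℤ), D'.flow t ∘ chainShift x =ᵐ[μ] chainShift x ∘ D'.flow t :=
    fun t x =>
      D'.flow_comp_chainShift_ae_of_carrier_subset_bmGood one_le_two one_le_two hU2 hV2 hcar.le hP' hSI t x
  -- the block correlations `Φ n t = ∫ J_n (J_n ∘ φ_t) dμ` and the Fejér representation of `C`
  set Φ : ℕ → ℝ → ℝ := fun n t => ∫ σ, (∑ i ∈ Finset.range n, (pinnedChain ω₂ lam β γ).bondCurrentZ σ i) *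
      (∑ k ∈ Finset.range n, (pinnedChain ω₂ lam β γ).bondCurrentZ (D'.flow t σ) k) ∂μ with hΦdef
  have hlim : ∀ t : ℝ, Tendsto (fun n : ℕ => (n : ℝ)⁻¹ * Φ n t) atTop
      (𝓝 (D.currentCorrelation μ t)) := fun t => by
    rw [hCC' t]
    exact D'.tendsto_inv_mul_integral_block_mul_block_flow hP' hSI hcomm' hj2 (hAC' t)
  have hJm : ∀ n : ℕ, Measurable fun σ : ChainConfig =>
      ∑ i ∈ Finset.range n, (pinnedChain ω₂ lam β γ).bondCurrentZ σ i := fun n =>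
    Finset.measurable_sum _ fun i _ => measurable_bondCurrentZ _ i
  have hJ2 : ∀ n : ℕ, MemLp (fun σ : ChainConfig =>
      ∑ i ∈ Finset.range n, (pinnedChain ω₂ lam β γ).bondCurrentZ σ i) 2 μ := fun n =>
    memLp_finsetSum _ fun i _ => hj2 i
  -- EVENNESS of each `Φ n`, hence of `C`
  have hΦeven : ∀ (n : ℕ) (t : ℝ), Φ n (-t) = Φ n t := fun n t =>
    D'.integral_mul_comp_flow_neg hP' (hJm n) t
  have heven : ∀ t : ℝ, D.currentCorrelation μ (-t) = D.currentCorrelation μ t := fun t =>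
    tendsto_nhds_unique (hlim (-t)) ((hlim t).congr fun n => by rw [hΦeven n t])
  -- POSITIVE TYPE of each `Φ n`, hence of `C`
  have hΦpsd : ∀ (n m : ℕ) (c τ : Fin m → ℝ), 0 ≤ ∑ i, ∑ j, c i * c j * Φ n (τ j - τ i) :=
    fun n m c τ => sum_mul_integral_mul_comp_flow_nonneg D' hP' (hJm n) (hJ2 n) m c τ
  have hpsd : ∀ (m : ℕ) (c τ : Fin m → ℝ),
      0 ≤ ∑ i, ∑ j, c i * c j * D.currentCorrelation μ (τ j - τ i) := by
    intro m c τ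
    have hl : Tendsto (fun n : ℕ => ∑ i, ∑ j, c i * c j * ((n : ℝ)⁻¹ * Φ n (τ j - τ i))) atTop
        (𝓝 (∑ i, ∑ j, c i * c j * D.currentCorrelation μ (τ j - τ i))) :=
      tendsto_finsetSum _ fun i _ => tendsto_finsetSum _ fun j _ => (hlim (τ j - τ i)).const_mul _
    refine ge_of_tendsto' hl fun n => ?_
    have e : ∑ i, ∑ j, c i * c j * ((n : ℝ)⁻¹ * Φ n (τ j - τ i)) =
        (n : ℝ)⁻¹ * ∑ i, ∑ j, c i * c j * Φ n (τ j - τ i) := by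
      rw [Finset.mul_sum]
      refine Finset.sum_congr rfl fun i _ => ?_
      rw [Finset.mul_sum]
      refine Finset.sum_congr rfl fun j _ => ?_
      ring
    rw [e]
    exact mul_nonneg (inv_nonneg.2 (Nat.cast_nonneg n)) (hΦpsd n m c τ)
  -- the cosine Bochner theorem (landed)
  obtain ⟨ρ, hρ, hcos⟩ :=
    Summit.AtomisticToContinuum.FouriersLaw.Theorems.MourreDissolution.stub_cosineBochner
      (fun t => D.currentCorrelation μ t) hCc heven hpsd
  exact ⟨ρ, hρ, fun t _ => hcos t⟩

end Summit.AtomisticToContinuum.FouriersLaw.Theorems.UnboundedHeatVariance.Birth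

end
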